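import Summits.HubbardSuperconductivity.HubbardSuperconductivity.Theorems.AnisotropyChordStiffnessCompressibility

/-!
# Route `AnisotropyChord` / H0 rotor rung: LEMMA ZM — the density mode `ρ_k ψ` (`k ≠ 0`) of a Perron sector ground
# state carries no weight at or below the sector ground energy; hypothesis (K) re-typed with its honest clause only
# (theory seat `hubbard-h0-rotor-theory-1`, cycle 9, work-order W11)

Clause (i) of `UniformSusceptibility` («`⟨vᵢ, ρ_k ψ⟩ = 0` whenever `ωᵢ ≤ 0`») is DISCHARGED:
* `ωᵢ < 0`: `sectorVanishing` (tree) — `ρ_k ψ` lies in the sector (`densityModeOp_mulVec_mem_spinZSector`);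
* `ωᵢ = 0` (**LEMMA ZM**, `densityAmp_eq_zero_of_excitation_eq_zero`): the sector projection `P_K vᵢ` is a sector
  ground vector (`[P_K, H] = 0`, tree `projMatrix_map_commute_of_invariant`), hence a multiple of `ψ` by Perron
  uniqueness (`sectorGround_eq_smul_perron`, from the tree's `xxz_sector_perron_pos`), and
  `⟨ψ, ρ_k ψ⟩ = Σ_s e^{ik·s} ⟨n_s⟩ = ρ̄ Σ_s e^{ik·s} = 0` by uniform density (`siteDensity_eq_of_isPerron`) and character
  orthogonality (`sum_torusPhase`).
Consequences: `densityAmp_eq_zero_of_excitation_nonpos` (clause (i) for every `L`, `Δ`, sector, `k ≠ 0`); the re-typed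
hypothesis **(K′) `BoundedDensityResponse Δ M`** = clause (ii) alone (`Σᵢ |⟨vᵢ,ρ_kψ⟩|²/ωᵢ ≤ κL²`), the link
`uniformSusceptibility_of_boundedDensityResponse : (K′) → (K)`, and the end-to-end theorem with (K′):
`eventualCondensate_of_stiffness_densityResponse`.
-/

set_option linter.dupNamespace false

noncomputable section

open Matrix Complex Finset Filter Topology
open scoped ComplexConjugate
open Literature.MathematicalPhysics.QuantumLattice hiding torusPhase torusNorm
open Literature.Probability.LatticeModels
open Summit.HubbardSuperconductivity.HubbardSuperconductivity.Theorems.AnisotropyChord.InsertionEntropy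

namespace Summit.HubbardSuperconductivity.HubbardSuperconductivity.Theorems.AnisotropyChord.Stiffness

/-- The density mode `ρ_k` (a diagonal operator) preserves every magnetisation sector. [folklore] -/
theorem densityModeOp_mulVec_mem_spinZSector (L : ℕ) [NeZero L] (k : TorusSite 2 L) (M : ℝ)
    {v : TensorIndex (TorusSite 2 L) 2 → ℂ} (hv : v ∈ spinZSector (Λ := TorusSite 2 L) 1 M) :
    densityModeOp L k *ᵥ v ∈ spinZSector (Λ := TorusSite 2 L) 1 M := by
  rw [mem_spinZSector_iff] at hv ⊢
  intro σ hσ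
  unfold densityModeOp
  rw [mulVec_diagonal, hv σ hσ, mul_zero]

/-- `⟨ψ, ρ_k ψ⟩ = Σ_s ρ_s e^{2πi k·s/L}` for a real amplitude (`ρ_s = ⟨n_s⟩` the site density). [folklore] -/
theorem dotProduct_densityModeOp_eq (L : ℕ) [NeZero L] (a : TensorIndex (TorusSite 2 L) 2 → ℝ)
    (k : TorusSite 2 L) :
    star (toC L a) ⬝ᵥ (densityModeOp L k *ᵥ toC L a) = ∑ s, ((siteDensity a s : ℝ) : ℂ) * torusPhase L k s := by
  unfold densityModeOp toC siteDensity dotProduct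
  simp only [mulVec_diagonal, Pi.star_apply, Complex.star_def, Complex.conj_ofReal]
  have h : ∀ σ : TensorIndex (TorusSite 2 L) 2,
      (a σ : ℂ) * ((∑ s, if σ s = 0 then torusPhase L k s else 0) * (a σ : ℂ))
        = ∑ s, ((if σ s = 0 then a σ ^ 2 else 0 : ℝ) : ℂ) * torusPhase L k s := by
    intro σ
    rw [Finset.sum_mul, Finset.mul_sum]
    refine Finset.sum_congr rfl fun s _ => ?_
    split_ifs <;> push_cast <;> ring
  rw [Finset.sum_congr rfl fun σ _ => h σ, Finset.sum_comm]
  refine Finset.sum_congr rfl fun s _ => ?_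
  rw [← Finset.sum_mul]
  push_cast
  rfl

/-- **`⟨ψ, ρ_k ψ⟩ = 0` for a Perron sector ground amplitude and `k ≠ 0`** (uniform density + character
orthogonality). [folklore] -/
theorem dotProduct_densityModeOp_perron_eq_zero (L : ℕ) [NeZero L] (Δ M : ℝ)
    (a : TensorIndex (TorusSite 2 L) 2 → ℝ) (ha : IsPerronSectorGroundAmplitude L Δ M a)
    {k : TorusSite 2 L} (hk : k ≠ 0) :
    star (toC L a) ⬝ᵥ (densityModeOp L k *ᵥ toC L a) = 0 := by
  rw [dotProduct_densityModeOp_eq]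
  simp_rw [siteDensity_eq_of_isPerron L Δ M a ha]
  rw [← Finset.mul_sum, sum_torusPhase, if_neg hk, mul_zero]

/-- **Perron uniqueness in the tree's currency:** every sector-`M` ground vector of `H(Δ)` on the torus is a multiple
of the Perron sector ground amplitude (tree `xxz_sector_perron_pos`). [folklore] -/
theorem sectorGround_eq_smul_perron (L : ℕ) [NeZero L] (Δ M : ℝ) (a : TensorIndex (TorusSite 2 L) 2 → ℝ)
    (ha : IsPerronSectorGroundAmplitude L Δ M a) {φ : TensorIndex (TorusSite 2 L) 2 → ℂ}
    (hφK : φ ∈ spinZSector (Λ := TorusSite 2 L) 1 M)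
    (hHφ : hcbHamiltonian L Δ *ᵥ φ = ((lowestEnergyInSector 1 (hcbHamiltonian L Δ) M : ℝ) : ℂ) • φ) :
    ∃ c : ℂ, φ = c • toC L a := by
  have hψ0 : toC L a ≠ 0 := by
    intro h0
    have : ∑ σ, a σ ^ 2 = 0 := Finset.sum_eq_zero fun σ _ => by
      have := congrFun h0 σ
      unfold toC at this
      simp only [Pi.zero_apply, Complex.ofReal_eq_zero] at this
      rw [this]; ring
    rw [ha.unit] at this
    exact one_ne_zero this
  obtain ⟨W, hW, hMW⟩ := exists_weight_of_mem_spinZSector ha.sector hψ0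
  obtain ⟨ψ₀, -, -, -, -, -, -, huniq⟩ :=
    xxz_sector_perron_pos (torusGraph 2 L) (torusGraph_connected_of_proj 2 L) Δ W hW
  have hsec := ha.sector
  have heig := ha.eigen
  rw [hMW] at hsec heig hφK hHφ
  obtain ⟨c₁, hc₁⟩ := huniq (toC L a) hsec heig
  obtain ⟨c₂, hc₂⟩ := huniq φ hφK hHφ
  have hc₁0 : c₁ ≠ 0 := by
    intro h0
    rw [h0, zero_smul] at hc₁
    exact hψ0 hc₁
  refine ⟨c₂ * c₁⁻¹, ?_⟩
  rw [hc₂, ← smul_smul]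
  congr 1
  rw [hc₁, smul_smul, inv_mul_cancel₀ hc₁0, one_smul]

/-- **LEMMA ZM (zero modes).**  For a Perron sector ground amplitude `ψ` of `H(Δ)` in the sector `M`, `k ≠ 0`, and an
eigenvector `vᵢ` of `H(Δ)` AT the sector ground energy (`ωᵢ = 0`): `⟨vᵢ, ρ_k ψ⟩ = 0`.  (`P_K vᵢ` is a sector ground
vector, hence `∥ ψ`, and `⟨ψ, ρ_k ψ⟩ = 0`.)  Theory seat work-order W11. [folklore] -/
theorem densityAmp_eq_zero_of_excitation_eq_zero (L : ℕ) [NeZero L] (Δ M : ℝ)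
    (a : TensorIndex (TorusSite 2 L) 2 → ℝ) (ha : IsPerronSectorGroundAmplitude L Δ M a)
    {k : TorusSite 2 L} (hk : k ≠ 0) (i : TensorIndex (TorusSite 2 L) 2) (hi : excitation L Δ M i = 0) :
    densityAmp L Δ a k i = 0 := by
  set hH := hcbHamiltonian_isHermitian L Δ with hHdef
  set K := spinZSector (Λ := TorusSite 2 L) 1 M with hKdef
  set P := projMatrix (K.map ((WithLp.linearEquiv 2 ℂ (TensorIndex (TorusSite 2 L) 2 → ℂ)).symm :
      (TensorIndex (TorusSite 2 L) 2 → ℂ) →ₗ[ℂ] EuclideanSpace ℂ (TensorIndex (TorusSite 2 L) 2)))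
    with hPdef
  set w := densityModeOp L k *ᵥ toC L a with hwdef
  have hwK : w ∈ K := densityModeOp_mulVec_mem_spinZSector L k M ha.sector
  have hinv : ∀ u ∈ K, hcbHamiltonian L Δ *ᵥ u ∈ K := fun u hu => hcb_mulVec_mem_spinZSector L Δ M hu
  -- the eigen-equation of `vᵢ` with eigenvalue `E₀(M)`
  have hE : hH.eigenvalues i = lowestEnergyInSector 1 (hcbHamiltonian L Δ) M := by
    have h := hi
    unfold excitation at h
    linarith
  have hv : hcbHamiltonian L Δ *ᵥ ⇑(hH.eigenvectorBasis i)
      = ((lowestEnergyInSector 1 (hcbHamiltonian L Δ) M : ℝ) : ℂ) • ⇑(hH.eigenvectorBasis i) := by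
    rw [hH.mulVec_eigenvectorBasis i, hE]
    funext σ
    simp only [Pi.smul_apply, Complex.real_smul, smul_eq_mul]
  -- `P vᵢ` is a sector ground vector, hence a multiple of `ψ`
  have huK : P *ᵥ ⇑(hH.eigenvectorBasis i) ∈ K := projMatrix_map_mulVec_mem K _
  have hHu : hcbHamiltonian L Δ *ᵥ (P *ᵥ ⇑(hH.eigenvectorBasis i))
      = ((lowestEnergyInSector 1 (hcbHamiltonian L Δ) M : ℝ) : ℂ) • (P *ᵥ ⇑(hH.eigenvectorBasis i)) := by
    rw [mulVec_mulVec, hPdef, ← projMatrix_map_commute_of_invariant hH K hinv, ← mulVec_mulVec, hv,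
      mulVec_smul]
  obtain ⟨c, hc⟩ := sectorGround_eq_smul_perron L Δ M a ha huK hHu
  -- `⟨vᵢ, w⟩ = ⟨vᵢ, P w⟩ = ⟨P vᵢ, w⟩ = conj c · ⟨ψ, w⟩ = 0`
  unfold densityAmp
  calc star (⇑(hH.eigenvectorBasis i)) ⬝ᵥ w
      = star (⇑(hH.eigenvectorBasis i)) ⬝ᵥ (P *ᵥ w) := by rw [projMatrix_map_mulVec_of_mem K hwK]
    _ = star (Pᴴ *ᵥ ⇑(hH.eigenvectorBasis i)) ⬝ᵥ w := by
        rw [star_mulVec, conjTranspose_conjTranspose, dotProduct_mulVec]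
    _ = star (P *ᵥ ⇑(hH.eigenvectorBasis i)) ⬝ᵥ w := by rw [(projMatrix_isHermitian _).eq]
    _ = star c * (star (toC L a) ⬝ᵥ w) := by rw [hc, star_smul, smul_dotProduct, smul_eq_mul]
    _ = 0 := by rw [hwdef, dotProduct_densityModeOp_perron_eq_zero L Δ M a ha hk, mul_zero]

/-- **Clause (i) of (K), DISCHARGED:** `⟨vᵢ, ρ_k ψ⟩ = 0` whenever `ωᵢ ≤ 0` (`ωᵢ < 0`: `sectorVanishing`;
`ωᵢ = 0`: LEMMA ZM), for every `L`, `Δ`, sector and `k ≠ 0`. [folklore] -/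
theorem densityAmp_eq_zero_of_excitation_nonpos (L : ℕ) [NeZero L] (Δ M : ℝ)
    (a : TensorIndex (TorusSite 2 L) 2 → ℝ) (ha : IsPerronSectorGroundAmplitude L Δ M a)
    {k : TorusSite 2 L} (hk : k ≠ 0) (i : TensorIndex (TorusSite 2 L) 2) (hi : excitation L Δ M i ≤ 0) :
    densityAmp L Δ a k i = 0 := by
  rcases lt_or_eq_of_le hi with hlt | heq
  · exact sectorVanishing L Δ M (densityModeOp_mulVec_mem_spinZSector L k M ha.sector) i hlt
  · exact densityAmp_eq_zero_of_excitation_eq_zero L Δ M a ha hk i heq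

/-- **HYPOTHESIS (K′) — `BoundedDensityResponse`** (bounded compressibility / static density response, the honest clause
of (K) alone): eventually in `L`, for the Perron amplitudes of both sectors `M_L`, `M_L − 1` and every `k ≠ 0`,
`Σᵢ |⟨vᵢ, ρ_k ψ⟩|²/ωᵢ ≤ κ L²` (`= χ_L(k)·|Λ|/2`).  With Lean's `x/0 = 0` and `densityAmp_eq_zero_of_excitation_nonpos`
the terms with `ωᵢ ≤ 0` vanish identically, so no support clause is needed.  A physical hypothesis of H0 (typing
authority theory seat `hubbard-h0-rotor-theory-1`, cycle 8/9, memo ROTOR-THEORY-8 §124 (e), work-order W11).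
[conjecture: theory seat hubbard-h0-rotor-theory-1, cycle 9, 2026-08-28 — hypothesis (K) of H0, clause (ii) (memo ROTOR-THEORY-8 §124 (e))] -/
def BoundedDensityResponse (Δ : ℝ) (M : ℕ → ℝ) : Prop :=
  ∃ κ : ℝ, ∀ᶠ L : ℕ in atTop, ∀ [NeZero L],
    ∀ a : TensorIndex (TorusSite 2 L) 2 → ℝ, ∀ M' ∈ ({M L, M L - 1} : Set ℝ),
      IsPerronSectorGroundAmplitude L Δ M' a → ∀ k : TorusSite 2 L, k ≠ 0 →
        ∑ i, ‖densityAmp L Δ a k i‖ ^ 2 / excitation L Δ M' i ≤ κ * (L : ℝ) ^ 2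

/-- **(K′) ⇒ (K):** the support clause of `UniformSusceptibility` is supplied by
`densityAmp_eq_zero_of_excitation_nonpos`. [folklore] -/
theorem uniformSusceptibility_of_boundedDensityResponse (Δ : ℝ) (M : ℕ → ℝ)
    (h : BoundedDensityResponse Δ M) : UniformSusceptibility Δ M := by
  obtain ⟨κ, hκ⟩ := h
  refine ⟨κ, ?_⟩
  filter_upwards [hκ] with L hL
  intro _ a M' hM' ha k hk
  exact ⟨fun i hi => densityAmp_eq_zero_of_excitation_nonpos L Δ M' a ha hk i hi, hL a M' hM' ha k hk⟩

/-- **(K) ⇒ (K′)** (the converse is trivial), so the two typings are equivalent. [folklore] -/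
theorem boundedDensityResponse_of_uniformSusceptibility (Δ : ℝ) (M : ℕ → ℝ)
    (h : UniformSusceptibility Δ M) : BoundedDensityResponse Δ M := by
  obtain ⟨κ, hκ⟩ := h
  refine ⟨κ, ?_⟩
  filter_upwards [hκ] with L hL
  intro _ a M' hM' ha k hk
  exact (hL a M' hM' ha k hk).2

/-- **THE H0 ROTOR RUNG, END TO END, with (K′):** «uniform helicity tensor (S_Υ) + bounded density response (K′) +
infrared Gaussianity of the insertion law (H1′) ⇒ Bose–Einstein condensation» on the density window — the tree's
`eventualCondensate_of_stiffness_compressibility` with the support clause of (K) discharged by LEMMA ZM. [folklore] -/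
theorem eventualCondensate_of_stiffness_densityResponse (Δ : ℝ) (M : ℕ → ℝ) (ρ : ℝ)
    (hρ : ρ ∈ Set.Ioo (0 : ℝ) 1)
    (hlim : Tendsto (fun L : ℕ => 1 / 2 + M L / (L : ℝ) ^ 2) atTop (nhds ρ))
    (hsect : ∀ᶠ L : ℕ in atTop, ∀ [NeZero L], spinZSector (Λ := TorusSite 2 L) 1 (M L - 1) ≠ ⊥)
    (hU : UniformHelicityTensor Δ M) (hK : BoundedDensityResponse Δ M)
    (hG : GaussianInsertionComparison Δ M) : EventualCondensate Δ M :=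
  eventualCondensate_of_stiffness_compressibility Δ M ρ hρ hlim hsect hU
    (uniformSusceptibility_of_boundedDensityResponse Δ M hK) hG

end Summit.HubbardSuperconductivity.HubbardSuperconductivity.Theorems.AnisotropyChord.Stiffness
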